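import Summits.HodgeConjecture.CorCM.IrreducibleOddWeightsHelly
import Summits.HodgeConjecture.CorCM.IrreducibleOddWeightsCoveringFamily
import HarnessLib

/-!
# The degree bound: `Hg(∏ A_i) = ∏ Hg(A_i)` is decided on sub-products of at most `max_i [K_i:ℚ]/2 + 1` factors

COR-CM (cell `pub-hodgecm2`, binder seat `b16` gen 59, count-neutral claim INDEX BOUND, file F5 — abstract `G`-set level
and CM fields; theorems only, no definition, no named fact, no `sorry`).  NEW as stated, hence under `Summits/`.  HONEST
FRAMING: unconditional finite-dimensional linear algebra over `ℚ` about the rank of families of CM types (= `dim` of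
the Mumford–Tate group of a product of CM abelian varieties; nondegenerate family = `Hg(∏ A_i) = ∏ Hg(A_i)` of maximal
rank ⟹ `B• = D•` and the Hodge conjecture on all products of the `A_i`, tree `CMAlgebra.IsNondegenerateFamily.…`);
`HC_CM` is neither used nor asserted.

THE OBSERVATION.  In the Helly number of gen 58 (`…Helly`: covering irreducibles `(π_k, V_k)` with `d_k ≤ q · δ_k` ⟹
sub-families of `≤ q + 1` members decide) only the irreducibles MEETING a member `U(Φ_i)` are needed, and an irreducible
`V_k` receiving a non-zero equivariant map from `U(Φ_i)` is a QUOTIENT of `U(Φ_i)`: `d_k ≤ dim U(Φ_i) = rank(Φ_i) − 1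
≤ |E_i|/2`.  Hence, with NO hypothesis on the group and no representation listed:

* **`typeRank_sigmaType_eq_iff_forall_card_le_of_finrank_antiSpan_le`**: if `dim U(Φ_i) ≤ q` for all `i`, the family
  is nondegenerate IFF every non-empty sub-family of at most `q + 1` members is;
* **`typeRank_sigmaType_eq_iff_forall_card_le_half_card_succ`**: `q = max_i |E_i|/2` always works — for CM fields,
  `q = max_i [K_i:ℚ]/2 = max_i dim A_i`: **`isNondegenerateFamily_iff_forall_card_le_of_finrank_le`** (`[K_i:ℚ] ≤ 2q`
  for all `i` ⟹ sub-families of `≤ q + 1` members decide), `exists_card_le_not_isNondegenerateFamily_of_finrank_le`, and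
  `hodgeConjectureFor_prod_of_forall_card_le_of_finrank_le` (HC with `B• = D•` on all products).

So: products of CM ELLIPTIC CURVES — pairs (classical); of CM abelian SURFACES (and elliptic curves) — TRIPLES; of CM
THREEFOLDS — quadruples; in general `(max_i dim A_i + 1)`-fold sub-products decide `Hg(∏ A_i) = ∏ Hg(A_i)`.  This
DEGREE BOUND and the INDEX BOUND of F3/F4 (`[Gal(L/ℚ) : A] + 1`, `A` abelian) are incomparable: the index bound wins
for fields with small non-abelian Galois closure relative to the degree (e.g. a Galois CM field of degree `2n` with
dihedral group: `3` against `n + 1`), the degree bound wins for generic fields (Galois closure `C₂ ≀ S_n`).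

## References

* [Mai1989] L. Mai, *Lower bounds for the ranks of CM types*, J. Number Theory 32 (1989), §2 Prop. 1 (proof).
* [Serre1977] J.-P. Serre, *Linear Representations of Finite Groups*, GTM 42 (1977), §1.4 Thm. 2, §2.2 Prop. 4.
* [Gordon1999HodgeAVSurvey] B. B. Gordon, *A survey of the Hodge conjecture for abelian varieties*, §3, 7.5–7.7, 10.10.
* [Shimura1998] G. Shimura, *Abelian Varieties with Complex Multiplication and Modular Functions*, §32.10 Prop.
-/

set_option autoImplicit false

noncomputable section

open scoped BigOperators

open CategoryTheory CategoryTheory.Limits NumberField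

universe u u' v w

namespace Summit.HodgeConjecture.CorCM

namespace IrrOdd

open Literature.NumberTheory.ComplexMultiplication

variable {G : Type w} [Group G] {I : Type u} {E : I → Type v} [∀ i, MulAction G (E i)] [Fintype I]
  [∀ i, Fintype (E i)]

/-! ### §1 Abstract slots: `dim U(Φ_i) ≤ q` for all `i` ⟹ sub-families of at most `q + 1` members decide -/

/-- **THE DEGREE BOUND (abstract).**  `G` permutes finite slots `E_i`, `Φ_i` are CM types for `ρ`, and
`dim U(Φ_i) ≤ q` for every `i` (e.g. `q = max_i |E_i|/2`).  THEN the family is nondegenerate —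
`rank(Σ) = |⊔_i E_i|/2 + 1`, `Hg(∏_i A_i) = ∏ Hg(A_i)` of maximal rank — IFF every non-empty sub-family of AT MOST `q + 1`
MEMBERS is.  (Covering irreducibles exist, F2; keep those of dimension `≤ q` — an irreducible `V_k` covering a
`P ≤ U(Φ_i)` is the image of `U(Φ_i)`, so `d_k ≤ q ≤ q δ_k`; Helly, gen 58.)  No hypothesis on `G`, no representation
listed. [cite: Mai1989, §2 Prop. 1 (proof)] [cite: Serre1977, §1.4 Thm. 2 and §2.2 Prop. 4]
[cite: Gordon1999HodgeAVSurvey, 7.5–7.7] -/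
theorem typeRank_sigmaType_eq_iff_forall_card_le_of_finrank_antiSpan_le [∀ i, Nonempty (E i)] [Nonempty I]
    {ρ : G} {Φ : ∀ i, Set (E i)} (h : ∀ i, IsCMTypeWith ρ (Φ i)) (q : ℕ)
    (hq : ∀ i, Module.finrank ℚ (antiSpan G (Φ i)) ≤ q) :
    typeRank G (sigmaType Φ) = Fintype.card (Σ i, E i) / 2 + 1 ↔
      ∀ T : Finset I, T.Nonempty → T.card ≤ q + 1 →
        typeRank G (sigmaType fun j : (T : Set I) => Φ j) = Fintype.card (Σ j : (T : Set I), E j) / 2 + 1 := by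
  classical
  obtain ⟨n, S, π, K, hπ, hirr, hne, hcov⟩ := exists_covering_irreducibles_slots (G := G) (E := E)
  -- keep the covering irreducibles of dimension `≤ q`
  let K' : Finset (Fin n) := K.filter fun k => Module.finrank ℚ (S k) ≤ q
  refine typeRank_sigmaType_eq_iff_forall_card_le (K := K') (V := fun k : K' => S k.1) h (fun k => π k.1)
    (fun k => hirr k.1)
    (fun k l hkl T => hne k.1 (Finset.mem_filter.1 k.2).1 l.1 (Finset.mem_filter.1 l.2).1
      (fun h' => hkl (Subtype.ext h')) T)
    (fun i P hPU hP0 hPst => ?_) q fun k => ?_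
  · -- an irreducible covering `P ≤ U(Φ_i)` is the image of `U(Φ_i)`: dimension `≤ q`
    obtain ⟨k, hk, T, hT, a, ha, ha0⟩ := hcov i P hP0 hPst
    have hdim : Module.finrank ℚ (S k) ≤ q := by
      haveI := hirr k
      let W : Subrepresentation (π k) := ⟨(antiSpan G (Φ i)).map T, fun g w hw => by
        obtain ⟨b, hb, rfl⟩ := hw
        refine ⟨fun s => b (g⁻¹ • s), comp_smul_mem_antiSpan hb g⁻¹, ?_⟩
        exact hT g b⟩
      rcases (hirr k).eq_bot_or_eq_top W with hW | hW
      · exfalso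
        apply ha0
        have hmem : T a ∈ W.toSubmodule := ⟨a, hPU ha, rfl⟩
        rw [hW] at hmem
        exact (Submodule.mem_bot ℚ).1 hmem
      · have htop : (antiSpan G (Φ i)).map T = ⊤ := congrArg Subrepresentation.toSubmodule hW
        calc Module.finrank ℚ (S k) = Module.finrank ℚ (⊤ : Submodule ℚ (S k)) := (finrank_top ℚ (S k)).symm
          _ = Module.finrank ℚ ((antiSpan G (Φ i)).map T) := by rw [htop]
          _ ≤ Module.finrank ℚ (antiSpan G (Φ i)) := Submodule.finrank_map_le T _
          _ ≤ q := hq i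
    exact ⟨⟨k, Finset.mem_filter.2 ⟨hk, hdim⟩⟩, T, hT, a, ha, ha0⟩
  · -- `d_k ≤ q ≤ q · δ_k`
    have hδ := finrank_intertwiningMap_pos (π k.1) (hirr k.1)
    calc Module.finrank ℚ (S k.1) ≤ q := (Finset.mem_filter.1 k.2).2
      _ ≤ q * Module.finrank ℚ ((π k.1).IntertwiningMap (π k.1)) := Nat.le_mul_of_pos_right q hδ

/-- **A degenerate family has a degenerate sub-family of at most `q + 1` members**, `q ≥ dim U(Φ_i)` for all `i`; no
hypothesis on `G`, no representation listed. [cite: Mai1989, §2 Prop. 1 (proof)] [cite: Gordon1999HodgeAVSurvey, 7.5–7.7] -/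
theorem exists_card_le_typeRank_sigmaType_ne_of_finrank_antiSpan_le [∀ i, Nonempty (E i)] [Nonempty I]
    {ρ : G} {Φ : ∀ i, Set (E i)} (h : ∀ i, IsCMTypeWith ρ (Φ i)) (q : ℕ)
    (hq : ∀ i, Module.finrank ℚ (antiSpan G (Φ i)) ≤ q)
    (hdeg : typeRank G (sigmaType Φ) ≠ Fintype.card (Σ i, E i) / 2 + 1) :
    ∃ T : Finset I, T.Nonempty ∧ T.card ≤ q + 1 ∧
      typeRank G (sigmaType fun j : (T : Set I) => Φ j) ≠ Fintype.card (Σ j : (T : Set I), E j) / 2 + 1 := by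
  by_contra hall
  push Not at hall
  exact hdeg ((typeRank_sigmaType_eq_iff_forall_card_le_of_finrank_antiSpan_le h q hq).2
    fun T hT hTc => hall T hT hTc)

/-- **`q = max_i |E_i|/2` ALWAYS WORKS**: `dim U(Φ_i) = rank(Φ_i) − 1 ≤ |E_i|/2` (Shimura: `r(φ) − 1 ≤ [K:ℚ]/2`), so a
family of CM types on slots with `|E_i| ≤ 2q` is nondegenerate iff every non-empty sub-family of at most `q + 1` members
is — the HELLY NUMBER OF DEGENERACY IS AT MOST HALF THE LARGEST SLOT. [cite: Shimura1998, §32.10 Prop.]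
[cite: Mai1989, §2 Prop. 1 (proof)] [cite: Gordon1999HodgeAVSurvey, 7.5–7.7] -/
theorem typeRank_sigmaType_eq_iff_forall_card_le_half_card_succ [∀ i, Nonempty (E i)] [Nonempty I]
    {ρ : G} {Φ : ∀ i, Set (E i)} (h : ∀ i, IsCMTypeWith ρ (Φ i)) (q : ℕ) (hq : ∀ i, Fintype.card (E i) ≤ 2 * q) :
    typeRank G (sigmaType Φ) = Fintype.card (Σ i, E i) / 2 + 1 ↔
      ∀ T : Finset I, T.Nonempty → T.card ≤ q + 1 →
        typeRank G (sigmaType fun j : (T : Set I) => Φ j) = Fintype.card (Σ j : (T : Set I), E j) / 2 + 1 :=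
  typeRank_sigmaType_eq_iff_forall_card_le_of_finrank_antiSpan_le h q fun i => by
    have h1 := (h i).typeRank_eq_finrank_antiSpan_add_one
    have h2 := (h i).typeRank_le
    have h3 := hq i
    omega

end IrrOdd

/-! ### §2 CM fields: sub-products of at most `max_i [K_i:ℚ]/2 + 1 = max_i dim A_i + 1` factors decide -/

open Literature.NumberTheory.ComplexMultiplication
open Literature.AlgebraicGeometry.Motives (AbelianVariety CMType)
open Literature.AlgebraicGeometry.HodgeTheory
open Literature.AlgebraicGeometry.ComplexMultiplication (IsCMTypeRealisation)
open Literature.AlgebraicGeometry.Pohlmann1968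
open Literature.AlgebraicGeometry.VanGeemen1994 (hodgeClassSpan)
open Literature.Barriers.HodgeConjecture (divisorClassesSpan)

variable {I : Type} [Fintype I] {K : I → Type} [∀ i, Field (K i)] [∀ i, NumberField (K i)] [∀ i, IsCMField (K i)]

/-- **THE DEGREE BOUND FOR PRODUCTS OF CM ABELIAN VARIETIES.**  CM fields `K_i` with `[K_i : ℚ] ≤ 2q` for all `i` (i.e.
`dim A_i ≤ q`), CM types `Φ_i`: the family is nondegenerate — `Hg(∏_i A_i) = ∏_i Hg(A_i)` of maximal rank — IFF every
non-empty sub-family of AT MOST `q + 1` MEMBERS is.  No Galois group, representation, certificate or character enters: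
CM elliptic curves — pairs; CM abelian surfaces — triples; CM threefolds — quadruples; …
[cite: Shimura1998, §32.10 Prop.] [cite: Mai1989, §2 Prop. 1 (proof)] [cite: Gordon1999HodgeAVSurvey, 7.5–7.7] -/
theorem isNondegenerateFamily_iff_forall_card_le_of_finrank_le [Nonempty I] (Φ : ∀ i, CMType (K i)) (q : ℕ)
    (hq : ∀ i, Module.finrank ℚ (K i) ≤ 2 * q) :
    CMAlgebra.IsNondegenerateFamily Φ ↔
      ∀ T : Finset I, T.Nonempty → T.card ≤ q + 1 →
        CMAlgebra.IsNondegenerateFamily (K := fun j : (T : Set I) => K j) fun j => Φ j := by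
  classical
  haveI : ∀ i, Nonempty (K i →+* ℂ) := fun i => inferInstance
  have hmain := IrrOdd.typeRank_sigmaType_eq_iff_forall_card_le_half_card_succ (E := fun i => K i →+* ℂ)
    (fun i => isCMTypeWith_conj (Φ i)) q fun i => by rw [Embeddings.card (K i) ℂ]; exact hq i
  have hcardI : Fintype.card (Σ i, (K i →+* ℂ)) = ∑ i, Module.finrank ℚ (K i) := by
    rw [Fintype.card_sigma]
    exact Finset.sum_congr rfl fun i _ => Embeddings.card (K i) ℂ
  have hcardT : ∀ T : Finset I, Fintype.card (Σ j : (T : Set I), (K j →+* ℂ)) =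
      ∑ j : (T : Set I), Module.finrank ℚ (K j) := by
    intro T
    rw [Fintype.card_sigma]
    exact Finset.sum_congr rfl fun j _ => Embeddings.card (K j) ℂ
  rw [CMAlgebra.isNondegenerateFamily_iff, ← hcardI]
  change typeRank (ℂ ≃+* ℂ) (sigmaType fun i => (Φ i).1) = _ ↔ _
  rw [hmain]
  refine forall_congr' fun T => forall_congr' fun hT => forall_congr' fun _ => ?_
  rw [CMAlgebra.isNondegenerateFamily_iff, ← hcardT T]
  rfl

/-- **A degenerate family of CM types of fields of degree `≤ 2q` has a degenerate sub-family of at most `q + 1` members**: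
exceptional Hodge classes on a product of CM abelian varieties of dimension `≤ q` are witnessed on a sub-product of at most
`q + 1` factors (or a factor is degenerate). [cite: Shimura1998, §32.10 Prop.] [cite: Gordon1999HodgeAVSurvey, 7.5–7.7] -/
theorem exists_card_le_not_isNondegenerateFamily_of_finrank_le [Nonempty I] (Φ : ∀ i, CMType (K i)) (q : ℕ)
    (hq : ∀ i, Module.finrank ℚ (K i) ≤ 2 * q) (hdeg : ¬ CMAlgebra.IsNondegenerateFamily Φ) :
    ∃ T : Finset I, T.Nonempty ∧ T.card ≤ q + 1 ∧
      ¬ CMAlgebra.IsNondegenerateFamily (K := fun j : (T : Set I) => K j) fun j => Φ j := by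
  by_contra hall
  push Not at hall
  exact hdeg ((isNondegenerateFamily_iff_forall_card_le_of_finrank_le Φ q hq).2 fun T hT hTc => hall T hT hTc)

variable {A : I → AbelianVariety ℂ} {ιA : ∀ i, 𝓞 (K i) →+* End (A i)}
  {θ : ∀ i, K i →+* Module.End ℂ (complexBetti (A i).X 1)}

/-- **HC ON ALL PRODUCTS FROM `(q+1)`-WISE NONDEGENERACY, `q ≥ max_i dim A_i`**: if `[K_i:ℚ] ≤ 2q` for all `i` and every
non-empty sub-family of at most `q + 1` of the CM types `Φ_i` is nondegenerate, then on every product `⨁_{j<N} A_{c j}`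
of realisations the Hodge conjecture holds with `B• = D•`. [cite: Gordon1999HodgeAVSurvey, 7.5 and 10.10]
[cite: Shimura1998, §32.10 Prop.] -/
theorem hodgeConjectureFor_prod_of_forall_card_le_of_finrank_le [Nonempty I] (Φ : ∀ i, CMType (K i)) (q : ℕ)
    (hq : ∀ i, Module.finrank ℚ (K i) ≤ 2 * q)
    (hsub : ∀ T : Finset I, T.Nonempty → T.card ≤ q + 1 →
      CMAlgebra.IsNondegenerateFamily (K := fun j : (T : Set I) => K j) fun j => Φ j)
    (hA : ∀ i, IsCMTypeRealisation (Φ i) (A i) (ιA i) (θ i)) {N : ℕ} (c : Fin N → I) :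
    HodgeConjectureFor (⨁ fun j : Fin N => A (c j)).dim (⨁ fun j : Fin N => A (c j)).X ∧
      ∀ m : ℕ, hodgeClassSpan (⨁ fun j : Fin N => A (c j)).dim (⨁ fun j : Fin N => A (c j)).X m =
        divisorClassesSpan (⨁ fun j : Fin N => A (c j)).X (⨁ fun j : Fin N => A (c j)).dim m := by
  have hnd : CMAlgebra.IsNondegenerateFamily Φ :=
    (isNondegenerateFamily_iff_forall_card_le_of_finrank_le Φ q hq).2 hsub
  exact ⟨hnd.hodgeConjectureFor_prod hA c, fun m => hnd.hodgeClassSpan_prod_eq_divisorClassesSpan hA c m⟩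

/-- **PRODUCTS OF CM ELLIPTIC CURVES AND CM ABELIAN SURFACES: TRIPLES DECIDE** (`[K_i:ℚ] ≤ 4`): if every sub-family of at
most three of the CM types is nondegenerate, HC holds with `B• = D•` on every product of realisations.
[cite: Gordon1999HodgeAVSurvey, 7.5 and 10.10] [cite: Shimura1998, §32.10 Prop.] -/
theorem hodgeConjectureFor_prod_of_forall_card_le_three_of_finrank_le_four [Nonempty I] (Φ : ∀ i, CMType (K i))
    (hq : ∀ i, Module.finrank ℚ (K i) ≤ 4)
    (hsub : ∀ T : Finset I, T.Nonempty → T.card ≤ 3 →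
      CMAlgebra.IsNondegenerateFamily (K := fun j : (T : Set I) => K j) fun j => Φ j)
    (hA : ∀ i, IsCMTypeRealisation (Φ i) (A i) (ιA i) (θ i)) {N : ℕ} (c : Fin N → I) :
    HodgeConjectureFor (⨁ fun j : Fin N => A (c j)).dim (⨁ fun j : Fin N => A (c j)).X ∧
      ∀ m : ℕ, hodgeClassSpan (⨁ fun j : Fin N => A (c j)).dim (⨁ fun j : Fin N => A (c j)).X m =
        divisorClassesSpan (⨁ fun j : Fin N => A (c j)).X (⨁ fun j : Fin N => A (c j)).dim m :=
  hodgeConjectureFor_prod_of_forall_card_le_of_finrank_le Φ 2 (fun i => by have := hq i; omega) hsub hA c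

end Summit.HodgeConjecture.CorCM

end
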